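import Summits.CriticalPhenomena.PercolationContinuityZ3.Theorems.PercNearOneGluingNoHeavyLowerTailThreePointProductFormFibreSeriesPieceCounts
import HarnessLib

/-!
# The series piece, IV: mask form and the mark pieces (Sahi programme, prover prim-sahi-p2 gen 59)

Support file (`--supports stmt-CriticalPhenomena-4575`, helper); continues `…ThreePointProductFormFibreSeriesPieceCounts` (same gen).
Standard axioms, no sorries, no named facts, no definitions.  Memo `run/shared/lean/prim/prim-sahi/FROM-prim-sahi-p2-gen59-ONE-STEP-LEMMA.md` §2, §8(2).

* `two_mul_card_series_*_mask` — the six series-piece identities of part III with Boolean masks (`piece = fun y => decide (y = e) || mQ y`,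
  sub-instance `mQ`), the form consumed by the tree assembly.
* `reachable_and_false` — in a configuration masked to nothing, connection is equality (the empty sub-instance).
The mark pieces (single labels `a — s`, `a — c`) are in the companion `…SeriesPieceMarks`.
[this work] (gen 59).
-/

namespace Summit.CriticalPhenomena.PercolationContinuityZ3.Theorems.ProductFormFibre

open Finset Literature.Probability.Percolation
open Summit.CriticalPhenomena.PercolationContinuityZ3.Theorems.ThreePointCPIClusterSwap (clusterFlip)

variable {V α : Type*}

section SeriesMask

variable [Fintype α] [DecidableEq α] [DecidableEq V]
  (ends : α → Sym2 V) (s a c u : V) (e : α) (mQ : α → Bool)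

omit [Fintype α] [DecidableEq α] [DecidableEq V] in
/-- In a configuration masked to nothing, connection is equality. [this work] -/
theorem reachable_and_false (w : α → Bool) (p q : V) :
    (openGraph (labelledOpen ends fun y => w y && false)).Reachable p q ↔ p = q := by
  have : openGraph (labelledOpen ends fun y => w y && false) = ⊥ := by
    ext x y
    simp only [openGraph_adj, labelledOpen, Set.mem_setOf_eq, Bool.and_false, SimpleGraph.bot_adj, iff_false, not_and]
    rintro ⟨l, hl, -⟩; exact absurd hl Bool.false_ne_true
  rw [this]; exact SimpleGraph.reachable_bot


open Classical in
/-- Mask form of `two_mul_card_series_S0`. [this work] -/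
theorem two_mul_card_series_S0_mask
    (he : ends e = s(a, u)) (hua : u ≠ a) (hsa : s ≠ a) (hca : c ≠ a)
    (hQu : ∀ l, mQ l = true → ∀ v ∈ ends l, v ≠ a) (heQ : mQ e = false) :
    2 * (univ.filter fun z : α → Bool =>
        ((¬ (openGraph (labelledOpen ends (fun y => z y && (decide (y = e) || mQ y)))).Reachable s a ∧
        ¬ (openGraph (labelledOpen ends (fun y => z y && (decide (y = e) || mQ y)))).Reachable s c) ∧
        (¬ (openGraph (labelledOpen ends (fun y => z y && (decide (y = e) || mQ y)))).Reachable c a ∧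
        ¬ (openGraph (labelledOpen ends (fun y => z y && (decide (y = e) || mQ y)))).Reachable c s))).card =
    (univ.filter fun z : α → Bool =>
        (¬ (openGraph (labelledOpen ends (fun y => z y && mQ y))).Reachable s c ∧
        ¬ (openGraph (labelledOpen ends (fun y => z y && mQ y))).Reachable c s)).card +
    (univ.filter fun z : α → Bool =>
        ((¬ (openGraph (labelledOpen ends (fun y => z y && mQ y))).Reachable s u ∧
        ¬ (openGraph (labelledOpen ends (fun y => z y && mQ y))).Reachable s c) ∧
        (¬ (openGraph (labelledOpen ends (fun y => z y && mQ y))).Reachable c u ∧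
        ¬ (openGraph (labelledOpen ends (fun y => z y && mQ y))).Reachable c s))).card := by
  have h := two_mul_card_series_S0 ends s a c u e (fun y => mQ y = true) he hua hsa hca hQu (by simp [heQ])
  simpa only [Bool.decide_or, Bool.decide_eq_true] using h


open Classical in
/-- Mask form of `two_mul_card_series_isoC`. [this work] -/
theorem two_mul_card_series_isoC_mask
    (he : ends e = s(a, u)) (hua : u ≠ a) (hsa : s ≠ a) (hca : c ≠ a)
    (hQu : ∀ l, mQ l = true → ∀ v ∈ ends l, v ≠ a) (heQ : mQ e = false) :
    2 * (univ.filter fun z : α → Bool =>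
        (¬ (openGraph (labelledOpen ends (fun y => z y && (decide (y = e) || mQ y)))).Reachable c a ∧
        ¬ (openGraph (labelledOpen ends (fun y => z y && (decide (y = e) || mQ y)))).Reachable c s)).card =
    (univ.filter fun z : α → Bool =>
        (¬ (openGraph (labelledOpen ends (fun y => z y && mQ y))).Reachable c s)).card +
    (univ.filter fun z : α → Bool =>
        (¬ (openGraph (labelledOpen ends (fun y => z y && mQ y))).Reachable c u ∧
        ¬ (openGraph (labelledOpen ends (fun y => z y && mQ y))).Reachable c s)).card := by
  have h := two_mul_card_series_isoC ends s a c u e (fun y => mQ y = true) he hua hsa hca hQu (by simp [heQ])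
  simpa only [Bool.decide_or, Bool.decide_eq_true] using h


open Classical in
/-- Mask form of `two_mul_card_series_isoS`. [this work] -/
theorem two_mul_card_series_isoS_mask
    (he : ends e = s(a, u)) (hua : u ≠ a) (hsa : s ≠ a) (hca : c ≠ a)
    (hQu : ∀ l, mQ l = true → ∀ v ∈ ends l, v ≠ a) (heQ : mQ e = false) :
    2 * (univ.filter fun z : α → Bool =>
        (¬ (openGraph (labelledOpen ends (fun y => z y && (decide (y = e) || mQ y)))).Reachable s a ∧
        ¬ (openGraph (labelledOpen ends (fun y => z y && (decide (y = e) || mQ y)))).Reachable s c)).card =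
    (univ.filter fun z : α → Bool =>
        (¬ (openGraph (labelledOpen ends (fun y => z y && mQ y))).Reachable s c)).card +
    (univ.filter fun z : α → Bool =>
        (¬ (openGraph (labelledOpen ends (fun y => z y && mQ y))).Reachable s u ∧
        ¬ (openGraph (labelledOpen ends (fun y => z y && mQ y))).Reachable s c)).card := by
  have h := two_mul_card_series_isoS ends s a c u e (fun y => mQ y = true) he hua hsa hca hQu (by simp [heQ])
  simpa only [Bool.decide_or, Bool.decide_eq_true] using h


open Classical in
/-- Mask form of `two_mul_card_series_Ga`. [this work] -/
theorem two_mul_card_series_Ga_mask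
    (he : ends e = s(a, u)) (hua : u ≠ a) (hsa : s ≠ a) (hca : c ≠ a)
    (hQu : ∀ l, mQ l = true → ∀ v ∈ ends l, v ≠ a) (heQ : mQ e = false) :
    2 * (univ.filter fun z : α → Bool =>
        (((¬ (openGraph (labelledOpen ends (fun y => z y && (decide (y = e) || mQ y)))).Reachable s a ∧
        ¬ (openGraph (labelledOpen ends (fun y => z y && (decide (y = e) || mQ y)))).Reachable s c) ∧
        (¬ (openGraph (labelledOpen ends (fun y => z y && (decide (y = e) || mQ y)))).Reachable c a ∧
        ¬ (openGraph (labelledOpen ends (fun y => z y && (decide (y = e) || mQ y)))).Reachable c s)) ∧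
        (¬ (openGraph (labelledOpen ends (fun l =>
          clusterFlip ends a (fun y => !(z y && (decide (y = e) || mQ y))) l && (decide (l = e) || mQ l)))).Reachable c a ∧
        ¬ (openGraph (labelledOpen ends (fun l =>
          clusterFlip ends a (fun y => !(z y && (decide (y = e) || mQ y))) l && (decide (l = e) || mQ l)))).Reachable c s))).card =
    (univ.filter fun z : α → Bool =>
        (¬ (openGraph (labelledOpen ends (fun y => z y && mQ y))).Reachable c u ∧
        ¬ (openGraph (labelledOpen ends (fun y => z y && mQ y))).Reachable c s)).card +
    (univ.filter fun z : α → Bool =>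
        (((¬ (openGraph (labelledOpen ends (fun y => z y && mQ y))).Reachable s u ∧
        ¬ (openGraph (labelledOpen ends (fun y => z y && mQ y))).Reachable s c) ∧
        (¬ (openGraph (labelledOpen ends (fun y => z y && mQ y))).Reachable c u ∧
        ¬ (openGraph (labelledOpen ends (fun y => z y && mQ y))).Reachable c s)) ∧
        ¬ (openGraph (labelledOpen ends (fun l => clusterFlip ends u (fun y => !(z y && mQ y)) l && mQ l))).Reachable c s)).card := by
  have h := two_mul_card_series_Ga ends s a c u e (fun y => mQ y = true) he hua hsa hca hQu (by simp [heQ])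
  simpa only [Bool.decide_or, Bool.decide_eq_true] using h


open Classical in
/-- Mask form of `two_mul_card_series_Gb`. [this work] -/
theorem two_mul_card_series_Gb_mask
    (he : ends e = s(a, u)) (hua : u ≠ a) (hsa : s ≠ a) (hca : c ≠ a)
    (hQu : ∀ l, mQ l = true → ∀ v ∈ ends l, v ≠ a) (heQ : mQ e = false) :
    2 * (univ.filter fun z : α → Bool =>
        (((¬ (openGraph (labelledOpen ends (fun y => z y && (decide (y = e) || mQ y)))).Reachable s a ∧
        ¬ (openGraph (labelledOpen ends (fun y => z y && (decide (y = e) || mQ y)))).Reachable s c) ∧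
        (¬ (openGraph (labelledOpen ends (fun y => z y && (decide (y = e) || mQ y)))).Reachable c a ∧
        ¬ (openGraph (labelledOpen ends (fun y => z y && (decide (y = e) || mQ y)))).Reachable c s)) ∧
        (¬ (openGraph (labelledOpen ends (fun l =>
          clusterFlip ends a (fun y => !(z y && (decide (y = e) || mQ y))) l && (decide (l = e) || mQ l)))).Reachable s a ∧
        ¬ (openGraph (labelledOpen ends (fun l =>
          clusterFlip ends a (fun y => !(z y && (decide (y = e) || mQ y))) l && (decide (l = e) || mQ l)))).Reachable s c))).card =
    (univ.filter fun z : α → Bool =>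
        (¬ (openGraph (labelledOpen ends (fun y => z y && mQ y))).Reachable s u ∧
        ¬ (openGraph (labelledOpen ends (fun y => z y && mQ y))).Reachable s c)).card +
    (univ.filter fun z : α → Bool =>
        (((¬ (openGraph (labelledOpen ends (fun y => z y && mQ y))).Reachable s u ∧
        ¬ (openGraph (labelledOpen ends (fun y => z y && mQ y))).Reachable s c) ∧
        (¬ (openGraph (labelledOpen ends (fun y => z y && mQ y))).Reachable c u ∧
        ¬ (openGraph (labelledOpen ends (fun y => z y && mQ y))).Reachable c s)) ∧
        ¬ (openGraph (labelledOpen ends (fun l => clusterFlip ends u (fun y => !(z y && mQ y)) l && mQ l))).Reachable c s)).card := by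
  have h := two_mul_card_series_Gb ends s a c u e (fun y => mQ y = true) he hua hsa hca hQu (by simp [heQ])
  simpa only [Bool.decide_or, Bool.decide_eq_true] using h


open Classical in
/-- Mask form of `two_mul_card_series_G1`. [this work] -/
theorem two_mul_card_series_G1_mask
    (he : ends e = s(a, u)) (hua : u ≠ a) (hsa : s ≠ a) (hca : c ≠ a)
    (hQu : ∀ l, mQ l = true → ∀ v ∈ ends l, v ≠ a) (heQ : mQ e = false) :
    2 * (univ.filter fun z : α → Bool =>
        (((¬ (openGraph (labelledOpen ends (fun y => z y && (decide (y = e) || mQ y)))).Reachable s a ∧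
        ¬ (openGraph (labelledOpen ends (fun y => z y && (decide (y = e) || mQ y)))).Reachable s c) ∧
        (¬ (openGraph (labelledOpen ends (fun y => z y && (decide (y = e) || mQ y)))).Reachable c a ∧
        ¬ (openGraph (labelledOpen ends (fun y => z y && (decide (y = e) || mQ y)))).Reachable c s)) ∧
        ((¬ (openGraph (labelledOpen ends (fun l =>
          clusterFlip ends a (fun y => !(z y && (decide (y = e) || mQ y))) l && (decide (l = e) || mQ l)))).Reachable s a ∧
        ¬ (openGraph (labelledOpen ends (fun l =>
          clusterFlip ends a (fun y => !(z y && (decide (y = e) || mQ y))) l && (decide (l = e) || mQ l)))).Reachable s c) ∧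
        (¬ (openGraph (labelledOpen ends (fun l =>
          clusterFlip ends a (fun y => !(z y && (decide (y = e) || mQ y))) l && (decide (l = e) || mQ l)))).Reachable c a ∧
        ¬ (openGraph (labelledOpen ends (fun l =>
          clusterFlip ends a (fun y => !(z y && (decide (y = e) || mQ y))) l && (decide (l = e) || mQ l)))).Reachable c s)))).card =
    (univ.filter fun z : α → Bool =>
        ((¬ (openGraph (labelledOpen ends (fun y => z y && mQ y))).Reachable s u ∧
        ¬ (openGraph (labelledOpen ends (fun y => z y && mQ y))).Reachable s c) ∧
        (¬ (openGraph (labelledOpen ends (fun y => z y && mQ y))).Reachable c u ∧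
        ¬ (openGraph (labelledOpen ends (fun y => z y && mQ y))).Reachable c s))).card +
    (univ.filter fun z : α → Bool =>
        (((¬ (openGraph (labelledOpen ends (fun y => z y && mQ y))).Reachable s u ∧
        ¬ (openGraph (labelledOpen ends (fun y => z y && mQ y))).Reachable s c) ∧
        (¬ (openGraph (labelledOpen ends (fun y => z y && mQ y))).Reachable c u ∧
        ¬ (openGraph (labelledOpen ends (fun y => z y && mQ y))).Reachable c s)) ∧
        ¬ (openGraph (labelledOpen ends (fun l => clusterFlip ends u (fun y => !(z y && mQ y)) l && mQ l))).Reachable c s)).card := by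
  have h := two_mul_card_series_G1 ends s a c u e (fun y => mQ y = true) he hua hsa hca hQu (by simp [heQ])
  simpa only [Bool.decide_or, Bool.decide_eq_true] using h


end SeriesMask

end Summit.CriticalPhenomena.PercolationContinuityZ3.Theorems.ProductFormFibre
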